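import Mathlib.RingTheory.Valuation.IsTrivialOn
import Mathlib.RingTheory.Valuation.ValuationSubring
import Mathlib.LinearAlgebra.Matrix.ToLin
import Mathlib.RingTheory.Algebraic.Integral
import Mathlib.FieldTheory.RatFunc.Basic
import Mathlib.Algebra.Polynomial.Roots
import Mathlib.FieldTheory.SplittingField.Construction
import Mathlib.GroupTheory.Subgroup.Saturated
import Mathlib.Data.Matrix.Mul
import HarnessLib

/-!
# Landau data, the Landau incidence matrix and the defect lattice of a degenerating family

Topic `Literature/NumberTheory/Transcendental`, beside `AyoubRelative*.lean`; definition request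
`defn-LandauDefectLattice` (route InverseLandau of the Kontsevich–Zagier summit, item
`NoDarkSingularities`; idea card `inverse-landau-rigidity-defect-lattice`).

**Setting.** A one-parameter family of rational integrands `F(z; ϖ)` on the cube `[0,1]ⁿ` over a
constant field `k`, degenerating as `ϖ → 0` (a *Tate family*: `F = P/Q`, `P, Q ∈ k[z][ϖ]`,
`Q(z, 0)` a non-zero constant, so that all singular strata of the polar divisor run to `∞`).
By analogy with the Landau analysis of Feynman integrals (Landau 1959; Pham; the "Landau
discriminants" of Mizera–Telen, JHEP 08 (2022) 200, and the principal `A`-determinant of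
Gelfand–Kapranov–Zelevinsky, Ch. 9–10), the family has a finite LANDAU SET of *Landau functions*
`Δ_α ∈ K^×`, `K = k(ϖ)^alg`, one for each way the polar divisor can meet a face stratum of the cube
non-transversally. For `n = 1` these are indexed by the pole branches `p ∈ K` of `F(·; ϖ)`; the
Landau function of `p` is `g_p := (p - 1)/p = exp ∫₀¹ dz/(z - p)`, whose zeros and poles on the
parameter curve are exactly the *endpoint events* `p = 1`, `p = 0`.

**The objects defined here** (all honest definitions; nothing is asserted):

* `Landau.monomial Δ n = ∏_α Δ_α ^ n_α` for a LANDAU DATUM `Δ : ι → Lˣ` (`ι` finite) and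
  `n ∈ ℤ^ι`; the lattice `Landau.relationLattice Δ` of exact multiplicative relations; and the
  **DEFECT LATTICE** `Landau.defectLattice k Δ := {n ∈ ℤ^ι | ∏_α Δ_α^{n_α} is algebraic over k}` —
  multiplicative relations MODULO CONSTANTS (the constant field of `L/k` is the relative algebraic
  closure of `k`, Stichtenoth Cor. 1.1.16). Proved: it is saturated; it is unchanged under any
  `k`-embedding `L → L'` (in particular under the reparametrisation `ϖ ↦ ϖ^e` and under passing
  to a bigger splitting field) and under an algebraic extension of the constants `k → k'`; and AT A
  TATE POINT — when every `Δ_α` is a principal unit `≡ 1 (mod 𝔪_c)` at some place `c` — it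
  coincides with the lattice of exact relations (`∏ Δ_α^{n_α} = 1`), because a constant `≡ 1` is `1`.
* `Landau.Place k L`: the points of the complete nonsingular model of the parameter curve =
  discrete valuations of `L/k` (Stichtenoth Def. 1.1.9: `ℤ ∪ {∞}`-valued, normalised, trivial on
  `k`), with `Place.ord` (`= v_P`, loc. cit. Def. 1.1.12) and the constructor
  `Place.ofPrimeElement` (loc. cit. Def. 1.1.9 (4)); the **LANDAU INCIDENCE MATRIX**
  `Landau.incidenceMatrix k Δ : Matrix (Place k L) ι ℤ`, entry `ord_c Δ_α` (the principal divisors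
  `(Δ_α)`, loc. cit. Def. 1.4.2, as columns); its integer kernel `Landau.matrixKer`. Proved:
  `defectLattice ≤ matrixKer (incidenceMatrix)` (constants have zero divisor), with equality under
  the hypothesis "`(x) = 0 ⇒ x` constant" (loc. cit. §1.4, from Cor. 1.1.20 — true for function
  fields of one variable; kept as an explicit hypothesis, it fails e.g. for `L = ⋃ₑ k(ϖ^{1/e})`).
* `n = 1`: `landauFn p = (p-1)/p`, `landauUnit`, the Landau set `landauSet K F = ` the poles in `K`
  of `F ∈ K₀(z)` (roots of the reduced denominator `F.denom`), the Landau datum `landauDatum`, the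
  canonical parameter curve `landauField F` (splitting field of the denominator over `K₀ = k(ϖ)`),
  and `landauIncidenceMatrix K k F` (`= M(F)`), `landauDefectLattice K k F` (`= Λ(F)`),
  `LandauDefectLattice` (the same lattice as a type). Proved: `ord_c g_p = ord_c (p - 1) - ord_c p`
  (the endpoint rows), and `g_p ≡ 1 (mod 𝔪_c)` whenever `p` has a pole at `c` (poles running to
  infinity), whence `Λ(F)` = exact relations among the `g_p` at a Tate point
  (`landauDefectLattice_eq_relationLattice`).

**Deliberately NOT here.** (i) The general-`n` Landau set (irreducible factors of the principal
`A`-determinant of `Q` restricted to the face strata): multivariate `A`-discriminants are not in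
Mathlib; the generic layer (`Landau.*`) takes the datum `Δ` as input so that it can be supplied
later. (ii) The theorem `matrixKer = defectLattice` for function fields of one variable
(existence of zeros and poles, Stichtenoth Cor. 1.1.20) — stated with its hypothesis explicit.
(iii) The bridge from a Tate family `(P, Q)` to an element of `AyoubRel.Odagger k` (expansion of
`1/Q` in `ϖ`) — a separate file. No monodromy / Picard–Lefschetz statement is made: the
identification "endpoint rows of `M(F)` = variation coefficients" is the requesting card's
heuristic, not a definition.

## References
* H. Stichtenoth, *Algebraic Function Fields and Codes*, 2nd ed., GTM 254 (2009), Defs. 1.1.9,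
  1.1.12, 1.1.15, 1.4.2, Cor. 1.1.16, Cor. 1.1.20 (`Stichtenoth2009`).
* S. Mizera, S. Telen, *Landau discriminants*, JHEP 08 (2022) 200 (`MizeraTelen2022`) — terminology.
* J. Ayoub, *La version relative de la conjecture des périodes de Kontsevich–Zagier revisitée*,
  Théorème 1.7 (`AyoubRelKZRevisited`) — the ambient relative period problem (`AyoubRelative.lean`).
-/

noncomputable section

open scoped WithZero Matrix
open Polynomial

namespace Literature.NumberTheory.Transcendental.AyoubRel

namespace Landau

/-! ### Landau data, monomials and the two lattices -/

section Lattice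

variable {ι : Type*} [Fintype ι] {L : Type*} [Field L]

/-- The Laurent monomial `∏_α Δ_α ^ n_α ∈ Lˣ` of a Landau datum `Δ : ι → Lˣ` with exponent vector
`n ∈ ℤ^ι`. [folklore] -/
def monomial (Δ : ι → Lˣ) (n : ι → ℤ) : Lˣ := ∏ α, Δ α ^ n α

/-- `Δ^0 = 1`. [folklore] -/
@[simp] theorem monomial_zero (Δ : ι → Lˣ) : monomial Δ 0 = 1 := by
  simp [monomial]

/-- `Δ^(m+n) = Δ^m Δ^n`. [folklore] -/
theorem monomial_add (Δ : ι → Lˣ) (m n : ι → ℤ) :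
    monomial Δ (m + n) = monomial Δ m * monomial Δ n := by
  simp [monomial, zpow_add, Finset.prod_mul_distrib]

/-- `Δ^(-n) = (Δ^n)⁻¹`. [folklore] -/
theorem monomial_neg (Δ : ι → Lˣ) (n : ι → ℤ) : monomial Δ (-n) = (monomial Δ n)⁻¹ := by
  simp [monomial, Finset.prod_inv_distrib]

/-- `Δ^(c • n) = (Δ^n)^c` for `c : ℕ`. [folklore] -/
theorem monomial_nsmul (Δ : ι → Lˣ) (c : ℕ) (n : ι → ℤ) :
    monomial Δ (c • n) = monomial Δ n ^ c := by
  simp only [monomial, Pi.smul_apply, ← Finset.prod_pow]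
  refine Finset.prod_congr rfl fun α _ => ?_
  rw [nsmul_eq_mul, mul_comm, zpow_mul, zpow_natCast]

/-- The underlying field element of `Δ^n` is `∏_α (Δ_α : L) ^ n_α`. [folklore] -/
theorem val_monomial (Δ : ι → Lˣ) (n : ι → ℤ) :
    ((monomial Δ n : Lˣ) : L) = ∏ α, ((Δ α : Lˣ) : L) ^ n α := by
  simp [monomial]

/-- Monomials commute with homomorphisms. [folklore] -/
theorem monomial_map {L' : Type*} [Field L'] (f : L →* L') (Δ : ι → Lˣ) (n : ι → ℤ) :
    monomial (fun α => Units.map f (Δ α)) n = Units.map f (monomial Δ n) := by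
  simp [monomial, map_prod, map_zpow]

/-- The monomial of a basis vector is the corresponding Landau function power. [folklore] -/
theorem monomial_single [DecidableEq ι] (Δ : ι → Lˣ) (α : ι) (e : ℤ) :
    monomial Δ (Pi.single α e) = Δ α ^ e := by
  rw [monomial, Finset.prod_eq_single α]
  · rw [Pi.single_eq_same]
  · intro β _ hβ
    rw [Pi.single_eq_of_ne hβ, zpow_zero]
  · intro h
    exact absurd (Finset.mem_univ α) h

/-- The lattice of EXACT multiplicative relations `{n ∈ ℤ^ι | ∏_α Δ_α^{n_α} = 1}` of a Landau
datum. [folklore] -/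
def relationLattice (Δ : ι → Lˣ) : AddSubgroup (ι → ℤ) where
  carrier := {n | monomial Δ n = 1}
  zero_mem' := monomial_zero Δ
  add_mem' {m n} hm hn := by
    simp only [Set.mem_setOf_eq] at hm hn ⊢
    rw [monomial_add, hm, hn, one_mul]
  neg_mem' {n} hn := by
    simp only [Set.mem_setOf_eq] at hn ⊢
    rw [monomial_neg, hn, inv_one]

/-- Membership in the relation lattice. [folklore] -/
@[simp] theorem mem_relationLattice {Δ : ι → Lˣ} {n : ι → ℤ} :
    n ∈ relationLattice Δ ↔ monomial Δ n = 1 :=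
  Iff.rfl

variable (k : Type*) [Field k] [Algebra k L]

/-- **The defect lattice** of a Landau datum `Δ : ι → Lˣ` over the constant field `k`:
`Λ := {n ∈ ℤ^ι | ∏_α Δ_α^{n_α} is a constant}`, i.e. the multiplicative relations among the Landau
functions MODULO CONSTANTS, a constant of `L/k` being an element algebraic over `k` (the field of
constants `k̃` of a function field, Stichtenoth Def. 1.1.15 / Cor. 1.1.16). When the places of
`L/k` detect constants this is the integer kernel of the Landau incidence matrix
(`matrixKer_incidenceMatrix_eq_defectLattice`). [folklore] -/
def defectLattice (Δ : ι → Lˣ) : AddSubgroup (ι → ℤ) where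
  carrier := {n | IsAlgebraic k ((monomial Δ n : Lˣ) : L)}
  zero_mem' := by
    simp only [Set.mem_setOf_eq, monomial_zero, Units.val_one]
    exact isAlgebraic_one
  add_mem' {m n} hm hn := by
    simp only [Set.mem_setOf_eq, monomial_add, Units.val_mul] at hm hn ⊢
    exact hm.mul hn
  neg_mem' {n} hn := by
    simp only [Set.mem_setOf_eq, monomial_neg, Units.val_inv_eq_inv_val] at hn ⊢
    exact hn.inv

variable {k}

/-- Membership in the defect lattice. [folklore] -/
@[simp] theorem mem_defectLattice {Δ : ι → Lˣ} {n : ι → ℤ} :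
    n ∈ defectLattice k Δ ↔ IsAlgebraic k ((monomial Δ n : Lˣ) : L) :=
  Iff.rfl

/-- Exact relations are relations modulo constants. [folklore] -/
theorem relationLattice_le_defectLattice (Δ : ι → Lˣ) :
    relationLattice Δ ≤ defectLattice k Δ := by
  intro n hn
  rw [mem_defectLattice, mem_relationLattice.1 hn, Units.val_one]
  exact isAlgebraic_one

/-- **The defect lattice is saturated**: `c • n ∈ Λ` with `c ≠ 0` forces `n ∈ Λ` (a `c`-th root of a
constant is a constant). [folklore] -/
theorem defectLattice_nsmulSaturated (Δ : ι → Lˣ) :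
    (defectLattice k Δ).toAddSubmonoid.NSMulSaturated := by
  intro c n hcn
  rcases Nat.eq_zero_or_pos c with hc | hc
  · exact Or.inl hc
  · right
    rw [AddSubgroup.mem_toAddSubmonoid, mem_defectLattice] at hcn ⊢
    rw [monomial_nsmul, Units.val_pow_eq_pow_val] at hcn
    exact IsAlgebraic.of_pow hc hcn

/-- Saturation, integer form: for `c ≠ 0`, `c • n ∈ Λ ↔ n ∈ Λ`. [folklore] -/
theorem zsmul_mem_defectLattice_iff (Δ : ι → Lˣ) {c : ℤ} (hc : c ≠ 0) (n : ι → ℤ) :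
    c • n ∈ defectLattice k Δ ↔ n ∈ defectLattice k Δ := by
  refine ⟨fun h => ?_, fun h => AddSubgroup.zsmul_mem _ h c⟩
  rcases (AddSubgroup.saturated_iff_zsmul.1 (defectLattice_nsmulSaturated (k := k) Δ)) c n h with
    h0 | hn
  · exact absurd h0 hc
  · exact hn

/-- **Functoriality in the parameter field**: the defect lattice is unchanged under any `k`-algebra
embedding `f : L → L'` of fields (e.g. enlarging the splitting field, or the reparametrisation
`ϖ ↦ ϖ^e` extended to algebraic closures). [folklore] -/
theorem defectLattice_map {L' : Type*} [Field L'] [Algebra k L'] (f : L →ₐ[k] L')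
    (Δ : ι → Lˣ) :
    defectLattice k (fun α => Units.map (f : L →* L') (Δ α)) = defectLattice k Δ := by
  ext n
  rw [mem_defectLattice, mem_defectLattice, monomial_map, Units.coe_map]
  exact isAlgebraic_algHom_iff f (f : L →+* L').injective

/-- **Functoriality in the constants**: replacing `k` by an algebraic extension `k'` (e.g. a finite
extension) does not change the defect lattice. [folklore] -/
theorem defectLattice_eq_of_isAlgebraic (k' : Type*) [Field k'] [Algebra k k'] [Algebra k' L]
    [IsScalarTower k k' L] [Algebra.IsAlgebraic k k'] (Δ : ι → Lˣ) :
    defectLattice k' Δ = defectLattice k Δ := by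
  ext n
  rw [mem_defectLattice, mem_defectLattice]
  exact ⟨fun h => h.restrictScalars k, fun h => h.tower_top k'⟩

end Lattice

/-! ### Places of the parameter curve and the order function -/

/-- A **place** of `L` over the constant field `k` = a point of the complete nonsingular model of
the curve with function field `L`: a discrete valuation of `L/k` in the sense of Stichtenoth —
`ℤ ∪ {∞}`-valued (here: multiplicative, `ℤᵐ⁰`-valued), normalised (surjective) and trivial on `k`.
[cite: Stichtenoth2009, Def. 1.1.9] -/
structure Place (k L : Type*) [Field k] [Field L] [Algebra k L] where
  /-- the underlying `ℤᵐ⁰`-valued valuation -/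
  val : Valuation L ℤᵐ⁰
  /-- normalisation: every value is attained (Stichtenoth Def. 1.1.9 (4)) -/
  surjective : Function.Surjective val
  /-- triviality on the constants (Stichtenoth Def. 1.1.9 (5)) -/
  isTrivialOn : val.IsTrivialOn k

namespace Place

variable {k L : Type*} [Field k] [Field L] [Algebra k L] (c : Place k L)

/-- The order `ord_c x = v_P(x) ∈ ℤ` of `x` at the place `c` (junk value `0` at `x = 0`); with
Mathlib's multiplicative convention `val x = exp (- ord_c x)`.
[cite: Stichtenoth2009, Def. 1.1.12] -/
def ord (x : L) : ℤ := -WithZero.log (c.val x)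

/-- `ord 0 = 0` (junk value). [folklore] -/
@[simp] theorem ord_zero : c.ord 0 = 0 := by simp [ord]

/-- `ord 1 = 0`. [folklore] -/
@[simp] theorem ord_one : c.ord 1 = 0 := by simp [ord]

/-- `ord (xy) = ord x + ord y` for `x, y ≠ 0`. [cite: Stichtenoth2009, Def. 1.1.9] -/
theorem ord_mul {x y : L} (hx : x ≠ 0) (hy : y ≠ 0) : c.ord (x * y) = c.ord x + c.ord y := by
  simp only [ord, map_mul]
  rw [WithZero.log_mul ((Valuation.ne_zero_iff _).2 hx) ((Valuation.ne_zero_iff _).2 hy)]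
  ring

/-- `ord x⁻¹ = - ord x`. [folklore] -/
theorem ord_inv (x : L) : c.ord x⁻¹ = -c.ord x := by
  simp [ord, map_inv₀, WithZero.log_inv]

/-- `ord (x ^ e) = e * ord x` for `e : ℤ`. [folklore] -/
theorem ord_zpow (x : L) (e : ℤ) : c.ord (x ^ e) = e * c.ord x := by
  simp only [ord, map_zpow₀, WithZero.log_zpow, smul_eq_mul]
  ring

/-- `ord` of a product of non-zero elements is the sum of the orders. [folklore] -/
theorem ord_prod {κ : Type*} (s : Finset κ) (f : κ → L) (hf : ∀ i ∈ s, f i ≠ 0) :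
    c.ord (∏ i ∈ s, f i) = ∑ i ∈ s, c.ord (f i) := by
  classical
  induction s using Finset.induction_on with
  | empty => simp
  | insert a s ha ih =>
    rw [Finset.prod_insert ha, Finset.sum_insert ha,
      c.ord_mul (hf a (Finset.mem_insert_self a s))
        (Finset.prod_ne_zero_iff.2 fun i hi => hf i (Finset.mem_insert_of_mem hi)),
      ih fun i hi => hf i (Finset.mem_insert_of_mem hi)]

/-- A non-zero CONSTANT (an element algebraic over `k`) has valuation `1` at every place
(`k̃ ⊆ 𝒪_P` and `k̃ ∩ P = {0}`). [cite: Stichtenoth2009, Prop. 1.1.5 (c)] -/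
theorem val_eq_one_of_isAlgebraic {x : L} (hx : IsAlgebraic k x) (h0 : x ≠ 0) : c.val x = 1 := by
  by_contra h
  haveI := c.isTrivialOn
  exact Valuation.transcendental_of_ne_one k x h0 h hx

/-- A constant has order `0` at every place (the principal divisor of a constant is `0`).
[cite: Stichtenoth2009, Prop. 1.1.5 (c)] -/
theorem ord_eq_zero_of_isAlgebraic {x : L} (hx : IsAlgebraic k x) : c.ord x = 0 := by
  by_cases h0 : x = 0
  · rw [h0, ord_zero]
  · simp [ord, c.val_eq_one_of_isAlgebraic hx h0]

/-- In particular `ord` vanishes on `k`. [cite: Stichtenoth2009, Def. 1.1.9] -/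
theorem ord_algebraMap (a : k) : c.ord (algebraMap k L a) = 0 :=
  c.ord_eq_zero_of_isAlgebraic (isAlgebraic_algebraMap a)

/-- Every place is non-trivial: some element has order `1` (a prime element).
[cite: Stichtenoth2009, Def. 1.1.9] -/
theorem exists_ord_eq_one : ∃ t : L, c.ord t = 1 := by
  obtain ⟨t, ht⟩ := c.surjective (WithZero.exp (-1))
  exact ⟨t, by simp [ord, ht]⟩

/-- Stichtenoth's form of the normalisation axiom: a `ℤᵐ⁰`-valued valuation trivial on `k` that
admits a PRIME ELEMENT `t` (`val t = exp (-1)`, i.e. `ord t = 1`) is a place.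
[cite: Stichtenoth2009, Def. 1.1.9] -/
def ofPrimeElement (v : Valuation L ℤᵐ⁰) [hv : v.IsTrivialOn k] (t : L)
    (ht : v t = WithZero.exp (-1)) : Place k L where
  val := v
  surjective y := by
    induction y using WithZero.expRecOn with
    | zero => exact ⟨0, map_zero v⟩
    | exp m =>
      refine ⟨t ^ (-m), ?_⟩
      rw [map_zpow₀, ht, ← WithZero.exp_zsmul, smul_eq_mul, mul_neg_one, neg_neg]
  isTrivialOn := hv

/-- The prime element of `ofPrimeElement` has order `1`. [folklore] -/
theorem ord_ofPrimeElement (v : Valuation L ℤᵐ⁰) [v.IsTrivialOn k] (t : L)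
    (ht : v t = WithZero.exp (-1)) : (ofPrimeElement (k := k) v t ht).ord t = 1 := by
  simp [ord, ofPrimeElement, ht]

/-- The order of a Landau monomial: `ord_c (∏ Δ_α^{n_α}) = ∑_α n_α · ord_c Δ_α`. [folklore] -/
theorem ord_monomial {ι : Type*} [Fintype ι] (Δ : ι → Lˣ) (n : ι → ℤ) :
    c.ord (monomial Δ n : L) = ∑ α, n α * c.ord (Δ α : L) := by
  rw [val_monomial, c.ord_prod _ _ fun α _ => zpow_ne_zero _ (Δ α).ne_zero]
  simp [ord_zpow]

/-- The **principal units** `1 + 𝔪_c` at the place `c`: units `u` with `val (u - 1) < 1`.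
[folklore] -/
def principalUnits : Subgroup Lˣ where
  carrier := {u | c.val ((u : L) - 1) < 1}
  one_mem' := by simp
  mul_mem' {u w} hu hw := by
    simp only [Set.mem_setOf_eq, Units.val_mul] at hu hw ⊢
    have e : (u : L) * w - 1 = ((u : L) - 1) * ((w : L) - 1) + (((u : L) - 1) + ((w : L) - 1)) := by
      ring
    rw [e]
    refine Valuation.map_add_lt _ ?_ (Valuation.map_add_lt _ hu hw)
    rw [map_mul]
    exact lt_of_le_of_lt (mul_le_of_le_one_right' hw.le) hu
  inv_mem' {u} hu := by
    simp only [Set.mem_setOf_eq] at hu ⊢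
    have h1 : c.val (u : L) = 1 := by
      have := Valuation.map_one_add_of_lt c.val hu
      rwa [add_sub_cancel] at this
    have e : ((u⁻¹ : Lˣ) : L) - 1 = -(((u⁻¹ : Lˣ) : L) * ((u : L) - 1)) := by
      rw [mul_sub, mul_one, ← Units.val_mul, inv_mul_cancel, Units.val_one]
      ring
    rw [e, Valuation.map_neg, map_mul, Units.val_inv_eq_inv_val, map_inv₀, h1, inv_one, one_mul]
    exact hu

/-- Membership in the principal units. [folklore] -/
@[simp] theorem mem_principalUnits {u : Lˣ} : u ∈ c.principalUnits ↔ c.val ((u : L) - 1) < 1 :=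
  Iff.rfl

/-- A monomial in principal units is a principal unit. [folklore] -/
theorem monomial_mem_principalUnits {ι : Type*} [Fintype ι] {Δ : ι → Lˣ}
    (h : ∀ α, Δ α ∈ c.principalUnits) (n : ι → ℤ) : monomial Δ n ∈ c.principalUnits :=
  Subgroup.prod_mem _ fun α _ => Subgroup.zpow_mem _ (h α) _

/-- **A constant which is a principal unit is `1`**: if `u ≡ 1 (mod 𝔪_c)` and `u` is algebraic over
`k` then `u = 1` (since `u - 1` is a constant of positive order). [folklore] -/
theorem eq_one_of_mem_principalUnits_of_isAlgebraic {u : Lˣ} (hu : u ∈ c.principalUnits)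
    (halg : IsAlgebraic k (u : L)) : u = 1 := by
  by_contra hne
  have hne' : (u : L) - 1 ≠ 0 := sub_ne_zero.2 fun h => hne (Units.val_eq_one.1 h)
  have halg' : IsAlgebraic k ((u : L) - 1) := halg.sub isAlgebraic_one
  have h1 := c.val_eq_one_of_isAlgebraic halg' hne'
  rw [mem_principalUnits, h1] at hu
  exact lt_irrefl _ hu

/-- **The defect lattice at a Tate point.** If every Landau function is a principal unit at some
place `c` (for a Tate family: at `ϖ = 0`, where all the `Δ_α` tend to `1`), then relations modulo
constants are exact relations: `Λ = {n | ∏ Δ_α^{n_α} = 1}`. [folklore] -/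
theorem defectLattice_eq_relationLattice_of_mem_principalUnits {ι : Type*} [Fintype ι]
    (Δ : ι → Lˣ) (h : ∀ α, Δ α ∈ c.principalUnits) :
    defectLattice k Δ = relationLattice Δ := by
  refine le_antisymm (fun n hn => ?_) (relationLattice_le_defectLattice Δ)
  exact c.eq_one_of_mem_principalUnits_of_isAlgebraic (c.monomial_mem_principalUnits h n) hn

end Place

/-! ### The Landau incidence matrix and its integer kernel -/

section Matrix

variable (k : Type*) {L : Type*} [Field k] [Field L] [Algebra k L] {ι : Type*}

/-- The **Landau incidence matrix** `M = (ord_c Δ_α)_{c, α}` of a Landau datum: rows indexed by the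
places `c` of `L/k` (points of the complete nonsingular parameter curve), columns by the Landau
set; the `α`-th column is the principal divisor `(Δ_α)`. [cite: Stichtenoth2009, Def. 1.4.2] -/
def incidenceMatrix (Δ : ι → Lˣ) : Matrix (Place k L) ι ℤ :=
  Matrix.of fun c α => c.ord (Δ α : L)

variable {k}

/-- Entries of the incidence matrix. [folklore] -/
@[simp] theorem incidenceMatrix_apply (Δ : ι → Lˣ) (c : Place k L) (α : ι) :
    incidenceMatrix k Δ c α = c.ord (Δ α : L) :=
  rfl

variable [Fintype ι]

/-- The integer kernel `ker_ℤ M = {n ∈ ℤ^ι | M n = 0}` of an integer matrix with (possibly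
infinitely many) rows indexed by `R`. [folklore] -/
def matrixKer {R : Type*} (M : Matrix R ι ℤ) : AddSubgroup (ι → ℤ) where
  carrier := {n | M *ᵥ n = 0}
  zero_mem' := Matrix.mulVec_zero M
  add_mem' {m n} hm hn := by
    simp only [Set.mem_setOf_eq] at hm hn ⊢
    rw [Matrix.mulVec_add, hm, hn, add_zero]
  neg_mem' {n} hn := by
    simp only [Set.mem_setOf_eq] at hn ⊢
    rw [Matrix.mulVec_neg, hn, neg_zero]

/-- Membership in the integer kernel. [folklore] -/
@[simp] theorem mem_matrixKer {R : Type*} {M : Matrix R ι ℤ} {n : ι → ℤ} :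
    n ∈ matrixKer M ↔ M *ᵥ n = 0 :=
  Iff.rfl

/-- An integer kernel is saturated. [folklore] -/
theorem matrixKer_nsmulSaturated {R : Type*} (M : Matrix R ι ℤ) :
    (matrixKer M).toAddSubmonoid.NSMulSaturated := by
  intro c n hcn
  rcases Nat.eq_zero_or_pos c with hc | hc
  · exact Or.inl hc
  · right
    rw [AddSubgroup.mem_toAddSubmonoid, mem_matrixKer] at hcn ⊢
    funext r
    have h := congr_fun hcn r
    rw [Matrix.mulVec_smul, Pi.smul_apply, Pi.zero_apply, smul_eq_zero] at h
    rcases h with h | h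
    · omega
    · exact h

/-- `M n` evaluated at the place `c` is the order of the monomial `∏ Δ_α^{n_α}` at `c`. [folklore] -/
theorem incidenceMatrix_mulVec (Δ : ι → Lˣ) (n : ι → ℤ) (c : Place k L) :
    (incidenceMatrix k Δ *ᵥ n) c = c.ord (monomial Δ n : L) := by
  rw [Place.ord_monomial, Matrix.mulVec, dotProduct]
  exact Finset.sum_congr rfl fun α _ => by rw [incidenceMatrix_apply, mul_comm]

/-- `n ∈ ker_ℤ M` iff the monomial `∏ Δ_α^{n_α}` has zero divisor. [folklore] -/
theorem mem_matrixKer_incidenceMatrix_iff {Δ : ι → Lˣ} {n : ι → ℤ} :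
    n ∈ matrixKer (incidenceMatrix k Δ) ↔ ∀ c : Place k L, c.ord (monomial Δ n : L) = 0 := by
  simp only [mem_matrixKer, funext_iff, incidenceMatrix_mulVec, Pi.zero_apply]

/-- **`Λ ⊆ ker_ℤ M`**: a relation modulo constants has zero divisor. [folklore] -/
theorem defectLattice_le_matrixKer (Δ : ι → Lˣ) :
    defectLattice k Δ ≤ matrixKer (incidenceMatrix k Δ) := fun _ hn =>
  mem_matrixKer_incidenceMatrix_iff.2 fun c => c.ord_eq_zero_of_isAlgebraic hn

/-- **`ker_ℤ M = Λ`** whenever the places of `L/k` detect constants ("`(x) = 0 ⇒ x ∈ k̃`", which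
holds for every algebraic function field of one variable, Stichtenoth §1.4 via Cor. 1.1.20; it is
an explicit hypothesis here). [cite: Stichtenoth2009, Cor. 1.1.20] -/
theorem matrixKer_incidenceMatrix_eq_defectLattice
    (hL : ∀ x : L, x ≠ 0 → (∀ c : Place k L, c.ord x = 0) → IsAlgebraic k x) (Δ : ι → Lˣ) :
    matrixKer (incidenceMatrix k Δ) = defectLattice k Δ :=
  le_antisymm (fun n hn => hL _ (monomial Δ n).ne_zero (mem_matrixKer_incidenceMatrix_iff.1 hn))
    (defectLattice_le_matrixKer Δ)

end Matrix

end Landau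

/-! ### Dimension one: pole branches and the Landau functions `g_p = (p - 1)/p` -/

section Curves

variable {K₀ : Type*} [Field K₀] (K : Type*) [Field K] [Algebra K₀ K]

/-- The **Landau function** of a pole branch `p`: `g_p := (p - 1)/p` (`= exp ∫₀¹ dz/(z - p)`; its
zeros/poles on the parameter curve are the endpoint events `p = 1` / `p = 0`). Junk value
`g_0 = 0`. [folklore] -/
def landauFn (p : K) : K := (p - 1) / p

/-- `g_p ≠ 0` unless `p ∈ {0, 1}`. [folklore] -/
theorem landauFn_ne_zero {p : K} (h0 : p ≠ 0) (h1 : p ≠ 1) : landauFn K p ≠ 0 :=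
  div_ne_zero (sub_ne_zero.2 h1) h0

/-- `g_p - 1 = -1/p`: poles running to infinity give Landau functions tending to `1`. [folklore] -/
theorem landauFn_sub_one {p : K} (h0 : p ≠ 0) : landauFn K p - 1 = -p⁻¹ := by
  rw [landauFn]
  field_simp
  ring

open scoped Classical in
/-- The Landau function `g_p` as a unit of `K` (junk value `1` when `p ∈ {0, 1}`, i.e. when the pole
sits identically at an endpoint of `[0, 1]`). [folklore] -/
def landauUnit (p : K) : Kˣ :=
  if h : p ≠ 0 ∧ p ≠ 1 then Units.mk0 (landauFn K p) (landauFn_ne_zero K h.1 h.2) else 1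

/-- The value of `landauUnit`. [folklore] -/
theorem val_landauUnit {p : K} (h0 : p ≠ 0) (h1 : p ≠ 1) :
    (landauUnit K p : K) = (p - 1) / p := by
  rw [landauUnit, dif_pos ⟨h0, h1⟩]
  rfl

/-- The **Landau set** (`n = 1`) of `F ∈ K₀(z)`: its pole branches in `K`, i.e. the roots in `K`
of the reduced (monic) denominator of `F`. [folklore] -/
abbrev landauSet (F : RatFunc K₀) : Set K := F.denom.rootSet K

/-- `p` is in the Landau set iff it is a root of the reduced denominator. [folklore] -/
theorem mem_landauSet_iff {F : RatFunc K₀} {p : K} :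
    p ∈ landauSet K F ↔ aeval p F.denom = 0 :=
  Polynomial.mem_rootSet_of_ne F.denom_ne_zero

/-- The **Landau datum** of `F` (`n = 1`): pole branch `p ↦ g_p`. [folklore] -/
def landauDatum (F : RatFunc K₀) : landauSet K F → Kˣ := fun p => landauUnit K (p : K)

/-- The canonical PARAMETER CURVE of `F ∈ K₀(z)` for its Landau analysis: the splitting field of
the reduced denominator over `K₀` (a finite extension of `K₀ = k(ϖ)`, hence again a function field
of one variable over `k`, on whose places the incidence matrix lives). Any field `K ⊇ K₀`
splitting the denominator gives the same defect lattice (`Landau.defectLattice_map`), but NOT the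
same incidence matrix: over an algebraic closure of `k(ϖ)` there are no `ℤ`-valued places at all.
[folklore] -/
abbrev landauField (F : RatFunc K₀) : Type _ := F.denom.SplittingField

variable (k : Type*) [Field k] [Algebra k K]

/-- The **Landau incidence matrix** `M(F) = (ord_c g_p)_{c, p}` of `F ∈ K₀(z)`: rows = places of
`K/k`, columns = pole branches. [folklore] -/
def landauIncidenceMatrix (F : RatFunc K₀) : Matrix (Landau.Place k K) (landauSet K F) ℤ :=
  Landau.incidenceMatrix k (landauDatum K F)

/-- **The defect lattice `Λ(F)`** of `F ∈ K₀(z)` over the constants `k`: exponent vectors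
`n ∈ ℤ^{poles}` with `∏_p g_p^{n_p}` constant (algebraic over `k`). [folklore] -/
def landauDefectLattice (F : RatFunc K₀) : AddSubgroup (landauSet K F → ℤ) :=
  Landau.defectLattice k (landauDatum K F)

/-- The defect lattice `Λ(F)` as a type (a finitely generated free `ℤ`-module). [folklore] -/
abbrev LandauDefectLattice (F : RatFunc K₀) : Type _ := ↥(landauDefectLattice K k F)

variable {K k}

/-- `Λ(F) ⊆ ker_ℤ M(F)`. [folklore] -/
theorem landauDefectLattice_le_matrixKer (F : RatFunc K₀) :
    landauDefectLattice K k F ≤ Landau.matrixKer (landauIncidenceMatrix K k F) :=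
  Landau.defectLattice_le_matrixKer _

/-- `Λ(F)` is saturated. [folklore] -/
theorem landauDefectLattice_nsmulSaturated (F : RatFunc K₀) :
    (landauDefectLattice K k F).toAddSubmonoid.NSMulSaturated :=
  Landau.defectLattice_nsmulSaturated _

/-- **Endpoint rows**: the column of `g_p` in the incidence matrix is the divisor of `p - 1` minus the
divisor of `p` (events `p = 1` and `p = 0`). [folklore] -/
theorem Landau.Place.ord_landauUnit (c : Landau.Place k K) {p : K} (h0 : p ≠ 0) (h1 : p ≠ 1) :
    c.ord (landauUnit K p : K) = c.ord (p - 1) - c.ord p := by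
  rw [val_landauUnit K h0 h1, div_eq_mul_inv, c.ord_mul (sub_ne_zero.2 h1) (inv_ne_zero h0),
    c.ord_inv, sub_eq_add_neg (c.ord (p - 1))]

/-- **Poles at infinity give principal units**: if `p` has a pole at `c` (`1 < val p`) then
`g_p ≡ 1 (mod 𝔪_c)`. [folklore] -/
theorem landauUnit_mem_principalUnits (c : Landau.Place k K) {p : K} (hp : 1 < c.val p) :
    landauUnit K p ∈ c.principalUnits := by
  have h0 : p ≠ 0 := fun h => by simp [h] at hp
  have h1 : p ≠ 1 := fun h => by simp [h] at hp
  rw [Landau.Place.mem_principalUnits, val_landauUnit K h0 h1, ← landauFn, landauFn_sub_one K h0,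
    Valuation.map_neg, map_inv₀]
  exact inv_lt_one_of_one_lt₀ hp

/-- **`Λ(F)` at a Tate point**: if every pole branch of `F` has a pole at the place `c` (all poles
run to infinity as `ϖ → 0`), then `Λ(F)` is the lattice of EXACT multiplicative relations among the
`g_p`. [folklore] -/
theorem landauDefectLattice_eq_relationLattice (F : RatFunc K₀) (c : Landau.Place k K)
    (hc : ∀ p : landauSet K F, 1 < c.val (p : K)) :
    landauDefectLattice K k F = Landau.relationLattice (landauDatum K F) :=
  c.defectLattice_eq_relationLattice_of_mem_principalUnits _ fun p =>
    landauUnit_mem_principalUnits c (hc p)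

end Curves

/-! ### Library fit (review notes on p48415): the local conveniences versus Mathlib's objects -/

section LibraryFit

/-- `Place.principalUnits` is Mathlib's `ValuationSubring.principalUnitGroup` of the valuation ring
of the place (the two valuations are equivalent). [folklore] -/
theorem Landau.Place.mem_principalUnits_iff_mem_principalUnitGroup {k L : Type*} [Field k]
    [Field L] [Algebra k L] (c : Landau.Place k L) (u : Lˣ) :
    u ∈ c.principalUnits ↔ u ∈ c.val.valuationSubring.principalUnitGroup := by
  rw [Landau.Place.mem_principalUnits, ValuationSubring.mem_principalUnitGroup_iff]
  exact (Valuation.isEquiv_valuation_valuationSubring c.val).lt_one_iff_lt_one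

/-- `matrixKer M` is the kernel of Mathlib's linear map `Matrix.mulVecLin M`, as an additive
subgroup. [folklore] -/
theorem Landau.matrixKer_eq_ker_mulVecLin {R ι : Type*} [Fintype ι] (M : Matrix R ι ℤ) :
    Landau.matrixKer M = (LinearMap.ker (Matrix.mulVecLin M)).toAddSubgroup := by
  ext n
  rw [Landau.mem_matrixKer, Submodule.mem_toAddSubgroup, LinearMap.mem_ker, Matrix.mulVecLin_apply]

end LibraryFit

end Literature.NumberTheory.Transcendental.AyoubRel
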